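import Literature.Probability.Percolation.QuadCrossingRotationInvariance
import Mathlib.Topology.MetricSpace.Thickening
import Mathlib.Analysis.Normed.Module.Convex
import HarnessLib

/-!
# Finite dependence and measurability of the Schramm–Smirnov quad-crossing event

Topic `Probability/Percolation`; second sibling proofs file of
`QuadCrossingRotationInvariance.lean` (the named fact `dkkmo_crossing_rotation_invariance`,
Duminil-Copin–Kozlowski–Krachun–Manolescu–Oulamara, arXiv:2012.11672v1, Cor. 1.3 at `q = 1`),
next to `QuadCrossingRotationInvarianceProofs.lean` (lattice symmetries).

The vendored event `quadCrossing R δ` ("some point of the side `(ab)` is joined to some point of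
`(cd)` by a continuous path inside the closed quad and inside the drawn open edges of `δℤ²`")
is stated for the full-plane product measure with no measurability claim (module docstring of
the fact: "for `δ > 0` the event depends on the finitely many edges meeting the bounded quad").
This file proves that remark, which every comparison of `P[𝒞_δ(Q)]` under a coupling — the
mechanism of the printed proof of Cor. 1.3 (§7.1: Theorem 1.2 gives a coupling, and one reads
off the crossing events) — needs:

* `closure_inter_openEdgeUnion_eq_of_subset`, `mem_quadCrossing_iff_inter_mem`: if a set of
  edges `E` contains every lattice edge whose drawn segment meets the closed quad, then `ω`
  crosses `Q` iff `ω ∩ E` does (locality);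
* `quadCrossing_eq_biUnion_of_subset`: the (increasing) event is the union over the crossing
  sub-configurations `S ⊆ E` of the cylinders `{ω | S ⊆ ω}`;
* `exists_finite_edges_meeting_quad`: for `δ > 0` there is such a finite `E` (both endpoints
  drawn within distance `δ` of the bounded closed quad; `meshVertices_finite`);
* `measurableSet_quadCrossing`: hence `quadCrossing R δ` is measurable for `δ > 0` (finite
  union of finite-dimensional cylinders of `Set (Sym2 ℤ²)`, `measurableSet_mem`).

## References

* [DKKMO2020Rotational] H. Duminil-Copin, K. K. Kozlowski, D. Krachun, I. Manolescu,
  M. Oulamara, arXiv:2012.11672v1 (2020), §1.2 p. 4 (the event `𝒞(Q)`), §7.1 p. 43.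
* [GrimmettPercolation1999] G. Grimmett, *Percolation*, 2nd ed. (1999), §2.1 (events depending
  on finitely many edges; cylinder events of the product space).
-/

noncomputable section

open MeasureTheory Set
open Literature.Probability.LatticeModels Literature.Probability.RandomPlanarGeometry

namespace Literature.Probability.Percolation

/-! ### Finite dependence and measurability of the crossing event -/

section Locality

variable {R : ConformalRectangle} {δ : ℝ} {E : Set (Sym2 (Site 2))}

/-- **Locality of the crossing event.** If `E` contains every lattice edge whose drawn segment
meets the closed quad, then inside the closed quad the open edges of `ω` and of `ω ∩ E` draw the
same set. [folklore] -/
theorem closure_inter_openEdgeUnion_eq_of_subset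
    (hE : ∀ x y : Site 2, (zdGraph 2).Adj x y →
      (segment ℝ (meshPoint δ x) (meshPoint δ y) ∩ closure R.carrier).Nonempty → s(x, y) ∈ E)
    (ω : BondConfig (Site 2)) :
    closure R.carrier ∩ openEdgeUnion δ ω = closure R.carrier ∩ openEdgeUnion δ (ω ∩ E) := by
  refine Subset.antisymm ?_ (inter_subset_inter_right _ (openEdgeUnion_mono δ inter_subset_left))
  rintro z ⟨hzR, hz⟩
  obtain ⟨x, y, hxy, hω, hzs⟩ := mem_openEdgeUnion_iff.1 hz
  exact ⟨hzR, mem_openEdgeUnion_iff.2 ⟨x, y, hxy, ⟨hω, hE x y hxy ⟨z, hzs, hzR⟩⟩, hzs⟩⟩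

/-- Hence the crossing event depends only on the edges in `E`: `ω` crosses `Q` iff `ω ∩ E`
does. [folklore] -/
theorem mem_quadCrossing_iff_inter_mem
    (hE : ∀ x y : Site 2, (zdGraph 2).Adj x y →
      (segment ℝ (meshPoint δ x) (meshPoint δ y) ∩ closure R.carrier).Nonempty → s(x, y) ∈ E)
    (ω : BondConfig (Site 2)) :
    ω ∈ quadCrossing R δ ↔ ω ∩ E ∈ quadCrossing R δ := by
  rw [mem_quadCrossing_iff, mem_quadCrossing_iff, closure_inter_openEdgeUnion_eq_of_subset hE ω]

/-- **Cylinder decomposition.** Under the same hypothesis the (increasing) crossing event is the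
union, over the sub-configurations `S ⊆ E` that cross `Q`, of the cylinders `{ω | S ⊆ ω}`.
[folklore] -/
theorem quadCrossing_eq_biUnion_of_subset
    (hE : ∀ x y : Site 2, (zdGraph 2).Adj x y →
      (segment ℝ (meshPoint δ x) (meshPoint δ y) ∩ closure R.carrier).Nonempty → s(x, y) ∈ E) :
    quadCrossing R δ = ⋃ S ∈ {S : Set (Sym2 (Site 2)) | S ⊆ E ∧ S ∈ quadCrossing R δ},
      {ω : BondConfig (Site 2) | S ⊆ ω} := by
  ext ω
  simp only [mem_iUnion, mem_setOf_eq, exists_prop]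
  constructor
  · intro hω
    exact ⟨ω ∩ E, ⟨inter_subset_right, (mem_quadCrossing_iff_inter_mem hE ω).1 hω⟩,
      inter_subset_left⟩
  · rintro ⟨S, ⟨-, hS⟩, hSω⟩
    exact isUpperSet_quadCrossing R δ hSω hS

/-- Under the same hypothesis with `E` finite, the crossing event is measurable (a finite union
of finite-dimensional cylinders of the product space `Set (Sym2 ℤ²)`). [folklore] -/
theorem measurableSet_quadCrossing_of_subset (hfin : E.Finite)
    (hE : ∀ x y : Site 2, (zdGraph 2).Adj x y →
      (segment ℝ (meshPoint δ x) (meshPoint δ y) ∩ closure R.carrier).Nonempty → s(x, y) ∈ E) :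
    MeasurableSet (quadCrossing R δ) := by
  rw [quadCrossing_eq_biUnion_of_subset hE]
  refine Finite.measurableSet_biUnion (hfin.finite_subsets.subset fun S hS => hS.1) fun S hS => ?_
  have hS : S.Finite := hfin.subset hS.1
  have : {ω : BondConfig (Site 2) | S ⊆ ω} = ⋂ e ∈ S, {ω : BondConfig (Site 2) | e ∈ ω} := by
    ext ω; simp [subset_def]
  rw [this]
  exact hS.measurableSet_biInter fun e _ => measurableSet_mem e

end Locality

/-- Mesh points of `ℤ²`-neighbours are at distance at most `|δ|` (in fact exactly `|δ|`).
[folklore] -/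
theorem norm_meshPoint_sub_meshPoint_le_of_adj (δ : ℝ) {x y : Site 2}
    (h : (zdGraph 2).Adj x y) : ‖meshPoint δ y - meshPoint δ x‖ ≤ |δ| := by
  have key : ∀ (u : Site 2) (i : Fin 2),
      ‖meshPoint δ (u + Pi.single i 1) - meshPoint δ u‖ ≤ |δ| := by
    intro u i
    have hre : (meshPoint δ (u + Pi.single i 1) - meshPoint δ u).re =
        δ * ((Pi.single i (1 : ℤ) : Site 2) 0 : ℤ) := by
      simp only [Complex.sub_re, meshPoint_re, Pi.add_apply, Int.cast_add]; ring
    have him : (meshPoint δ (u + Pi.single i 1) - meshPoint δ u).im =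
        δ * ((Pi.single i (1 : ℤ) : Site 2) 1 : ℤ) := by
      simp only [Complex.sub_im, meshPoint_im, Pi.add_apply, Int.cast_add]; ring
    have hsq : ‖meshPoint δ (u + Pi.single i 1) - meshPoint δ u‖ ^ 2 = |δ| ^ 2 := by
      rw [Complex.sq_norm, Complex.normSq_apply, hre, him, sq_abs]
      fin_cases i <;> simp [sq]
    have h1 : ‖meshPoint δ (u + Pi.single i 1) - meshPoint δ u‖ = |δ| := by
      rw [← Real.sqrt_sq (norm_nonneg _), hsq, Real.sqrt_sq (abs_nonneg δ)]
    exact h1.le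
  obtain ⟨i, h | h⟩ := (zdGraph_adj_iff x y).1 h
  · rw [h]; exact key x i
  · rw [h, ← norm_neg, neg_sub]; exact key y i

/-- For `δ > 0` only finitely many lattice edges are drawn through the (bounded) closed quad:
there is a finite set of edges containing every edge whose drawn segment meets `closure Q`
(the edges with both endpoints drawn within distance `δ` of the closed quad). [folklore] -/
theorem exists_finite_edges_meeting_quad (R : ConformalRectangle) {δ : ℝ} (hδ : 0 < δ) :
    ∃ E : Set (Sym2 (Site 2)), E.Finite ∧ ∀ x y : Site 2, (zdGraph 2).Adj x y →
      (segment ℝ (meshPoint δ x) (meshPoint δ y) ∩ closure R.carrier).Nonempty → s(x, y) ∈ E := by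
  set V : Set (Site 2) := meshVertices (Metric.cthickening δ (closure R.carrier)) δ with hV
  have hVfin : V.Finite := meshVertices_finite R.isBounded.closure.cthickening hδ
  refine ⟨(fun p : Site 2 × Site 2 => s(p.1, p.2)) '' V ×ˢ V, (hVfin.prod hVfin).image _, ?_⟩
  have hmem : ∀ x y : Site 2, (zdGraph 2).Adj x y → ∀ z ∈ segment ℝ (meshPoint δ x) (meshPoint δ y),
      z ∈ closure R.carrier → x ∈ V := fun x y hxy z hzs hzR => by
    rw [hV, mem_meshVertices_iff]
    refine Metric.mem_cthickening_of_dist_le _ z _ _ hzR ?_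
    rw [dist_comm, dist_eq_norm]
    exact (norm_sub_le_of_mem_segment hzs).trans
      ((norm_meshPoint_sub_meshPoint_le_of_adj δ hxy).trans (abs_of_pos hδ).le)
  rintro x y hxy ⟨z, hzs, hzR⟩
  refine ⟨(x, y), ⟨hmem x y hxy z hzs hzR, hmem y x hxy.symm z ?_ hzR⟩, rfl⟩
  rwa [segment_symm]

/-- **The quad-crossing event is measurable** (`δ > 0`): it is a finite union of cylinder events
of the product space of bond configurations, since only the finitely many edges drawn through
the bounded closed quad matter (`exists_finite_edges_meeting_quad`,
`quadCrossing_eq_biUnion_of_subset`). The vendored fact makes no measurability claim; this is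
the lemma needed to compare `P[𝒞_δ(Q)]` under couplings. [folklore] -/
theorem measurableSet_quadCrossing (R : ConformalRectangle) {δ : ℝ} (hδ : 0 < δ) :
    MeasurableSet (quadCrossing R δ) := by
  obtain ⟨E, hfin, hE⟩ := exists_finite_edges_meeting_quad R hδ
  exact measurableSet_quadCrossing_of_subset hfin hE

end Literature.Probability.Percolation
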